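import Literature.AlgebraicGeometry.HodgeTheory.FermatHypersurfaceReduction
import Literature.AlgebraicGeometry.HodgeTheory.FermatRationalSupport
import Literature.AlgebraicGeometry.HodgeTheory.DiagonalSymmetryStability
import Literature.AlgebraicGeometry.HodgeTheory.FermatHodgeCharacters
import Literature.AlgebraicGeometry.HodgeTheory.HypersurfaceLefschetzProofs
import HarnessLib

/-!
# The Hodge conjecture for Fermat varieties: Ran's assembly of the middle degree from the eigenspace structure

Family `hodge`, layer `Literature/AlgebraicGeometry/HodgeTheory`. Proof file (top layer of the
middle degree) for the named fact `hodgeClasses_algebraic_fermat` (file `FermatHodgeConjecture`;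
Shioda, Proc. Japan Acad. 55A (1979) §2 Thm. 1; Ran, Compositio Math. 42 (1980) Thm. 4.9), on the
STANDARD MODEL `X = V₊(x₀ᵐ + ⋯ + x_{2p+1}ᵐ) ⊂ ℙ²ᵖ⁺¹_ℂ` (`fermatHypersurface (2p) m`, to which the
fact is reduced by `hodgeClasses_algebraic_fermat_of_fermatHypersurface`). Everything is PROVED; no
named fact is introduced.

Ran's proof of Thm. 4.9 (p. 141: "In view of Prop. 1.7 (iii), Cor. 4.7 and §3 the proof is
immediate") and Shioda's of Thm. 1 (PJA §4; Math. Ann. 245 (1979) §1–§4) both run: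

1. (Prop. 1.7 (iii) / Shioda Math. Ann. Thm. I) the complexification of the rational
   `(p, p)`-classes of `H²ᵖ(X²ᵖₘ)` is `V(0) ⊕ ⨁_{α ∈ 𝔅} V(α)`, `𝔅 = 𝔅²ᵖₘ` the Hodge characters,
   which follows from the `ℚ`-structure (`π_α c ≠ 0 ⟺ π_{tα} c ≠ 0` for rational `c` and units `t`)
   and the eigenspace structure of `Hⁿ(Xⁿₘ(ℂ); ℂ)` under `μₘⁿ⁺²` (Prop. 1.7 (i)–(ii): only `α = 0`
   and the `α` with all `αᵢ ≠ 0`, `Σ αᵢ = 0` occur in degree `n`, and `V(α) ⊂ H^{n+1-|α|, |α|-1}`);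
2. (§§2–3, Cor. 4.7 / Shioda's condition `(Pⁿₘ)` and inductive structure) for every Hodge
   character `α` the line `V(α)` consists of classes of algebraic cycles — for `m` prime because
   `α` is a juxtaposition of pairs `(a, -a)` (Prop. 1.8 (i)) and such `V(α)` lie in the span of the
   classes of the linear subspaces `x_i = ε x_{σ i}`.

This file proves the IMPLICATION "eigenspace structure (1) + algebraicity of the Hodge lines (2) ⟹
the middle-degree case", with the inputs of (1) and (2) that the tree does not have as EXPLICIT
HYPOTHESES stated on the tree's carriers (`fermatEigenspace`, `HodgeModel.hodgePQ`,
`algebraicClasses`), exactly as `hodgeClasses_algebraic_fermat_of_middle` treats the middle degree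
and `lefschetzOneOne_rational_of` its analytic input (fact-decomposition discipline: proof
obligations of the parent along the printed proof, not separately tracked facts):

* `FermatCharacter.isHodge_of_fermatProjector_ne_zero` — **step (1) for one character**: granted the
  Hodge types of the eigenspaces in the only case used (hypothesis `hE4`: if `V(α)`, all `αᵢ ≠ 0`,
  contains a non-zero class whose pull-back to a Hodge model `A` is of type `(p, p)`, then
  `|α| = p + 1`, i.e. `2 Σ⟨αᵢ⟩ = m (2p + 2)` — the `(p, p)` case of Ran Prop. 1.7 (ii)
  `V_χ ⊂ H^{n - s(χ)/m, s(χ)/m}`, Shioda Math. Ann. (1.7) `V(α) ⊂ H^{|α|-1, n+1-|α|}`, a condition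
  invariant under `α ↦ -α` since `|α| + |-α| = n + 2`), a character `α` with all `αᵢ ≠ 0` carrying
  a non-zero component `π_α c` of a RATIONAL class `c` of type `(p, p)` is a Hodge character:
  `Σ αᵢ = 0` by `fermatEigenspace_eq_bot_of_sum_ne_zero`, and for every unit `t`, `π_{tα} c ≠ 0`
  (`fermatProjector_ne_zero_of_unitMul`, the `ℚ`-structure) is again of type `(p, p)` in the SAME
  model (`HodgeModel.pullback_eigenProjector_mem_hodgePQ`), whence `|tα| = p + 1`.
* `mem_algebraicClasses_fermat_middle_of_eigenspaces` — **the assembly of the middle degree**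
  (Ran Thm. 4.9, first sentence; Shioda Thm. 1 modulo `(Pⁿₘ)`): granted moreover that `V(α) = 0` in
  degree `n` for `α ≠ 0` with some `αᵢ = 0` (`hE2`, Prop. 1.7 (i)), that `V(0) ∩ Hⁿ` is restricted
  from `ℙⁿ⁺¹` (`hE0`: `Hⁿ(X)^G = Hⁿ(X/G) = Hⁿ(ℙⁿ) = ℂ hᵖ`, Shioda Math. Ann. §1) and that `V(α)`
  consists of algebraic classes for every Hodge character `α` (`hB`), every rational `(p,p)`-class
  `c = Σ_α π_α c` (`sum_fermatProjector`) is algebraic: `π_0 c` by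
  `range_map_projectiveSpace_le_algebraicClasses` (tree, PROVED), the other non-zero components by
  the previous item and `hB`.
* `mem_algebraicClasses_fermat_middle_prime_of_eigenspaces` — **prime degree** (Ran Thm. 4.9,
  "e.g., `m` is prime … the Hodge subspace is generated by the homology classes of linear spaces"):
  for `m = ℓ` prime it suffices that `V(α)` be algebraic for the PAIRED characters (`hL`; the
  classes of linear subspaces), by the tree's PROVED `FermatCharacter.IsHodge.isPaired` (Ran
  Prop. 1.8 (i), Koblitz–Ogus).
* `hodgeClasses_algebraic_fermat_of_eigenspaces` — the named fact from Lefschetz off the middle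
  degree (`Voisin2003_smoothHypersurface_algebraicClasses_eq_top`) and the four middle-degree inputs
  for all `p > 0` and all `m` prime or `1 < m ≤ 20`.

## What is NOT here (the remaining inputs, as they appear in the hypotheses)

`hE2`, `hE4` (Ran Prop. 1.7 (i)–(ii): the `μₘⁿ⁺²`-structure and Hodge types of `Hⁿ(Xⁿₘ(ℂ); ℂ)`,
by Griffiths residues / Ogus, or Pham's computation of the affine Fermat hypersurface), `hE0`
(`Hⁿ(Xⁿₘ)^{G} = ℂ hⁿᐟ²`: transfer for the finite quotient `Xⁿₘ → ℙⁿ`, `[xᵢ] ↦ [xᵢᵐ]`), and `hB`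
(for `m` prime: the classes of the linear subspaces have `π_α cl(L) ≠ 0` for the paired `α`, Ran
§§2–3; for composite `m ≤ 20`: Shioda's inductive structure and condition `(Pⁿₘ)`, file
`FermatShiodaCondition`). None of these is a named fact of the tree; they are the next layers.

## References

* [Ran1980] Z. Ran, Cycles on Fermat hypersurfaces, Compositio Math. 42 (1980) 121–142: §1
  Prop. 1.7 (i)–(iii) (p. 125), Prop. 1.8 (i) (p. 126), Thm. 4.9 (p. 141) (text read, numdam).
* [Shioda1979PJA] T. Shioda, The Hodge conjecture and the Tate conjecture for Fermat varieties,
  Proc. Japan Acad. 55A (1979) 111–114, §1 (`𝔅ⁿₘ`), §2 Thm. 1, §4 (text read).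
* [Shioda1979HodgeFermat] T. Shioda, The Hodge conjecture for Fermat varieties, Math. Ann. 245
  (1979) 175–184, §1 (Thm. I: `(H^{p,p} ∩ Hⁿ(X, ℚ)) ⊗ ℂ = V(0) ⊕ ⨁_{α ∈ 𝔅} V(α)`) (cite-only).
* [VoisinHodgeII2003] C. Voisin, Hodge Theory and Complex Algebraic Geometry II (2003), §1.2.3
  Cor. 1.24 (classes restricted from projective space are algebraic; through the tree's
  `range_map_projectiveSpace_le_algebraicClasses`).
-/

noncomputable section

open CategoryTheory AlgebraicGeometry MvPolynomial

namespace Literature.AlgebraicGeometry.HodgeTheory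

open Literature.AlgebraicGeometry.Motives Literature.AlgebraicTopology.SingularHomology

variable {p m : ℕ}

/-! ### Step (1): the support of a rational `(p, p)`-class consists of Hodge characters -/

/-- **A character carrying a non-zero component of a rational `(p, p)`-class is a Hodge character**
(granted the Hodge types of the eigenspaces). On `X = V₊(Σᵢ₌₀^{2p+1} xᵢᵐ)`, let `c ∈ H²ᵖ(X(ℂ); ℂ)`
be rational with `A^* c ∈ H^{p,p}_A` for a Hodge model `A`, and let `α ∈ (ℤ/m)²ᵖ⁺²` have all
`αᵢ ≠ 0` and `π_α c ≠ 0`. Assume (`hE4`, the `(p, p)` case of Ran Prop. 1.7 (ii)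
`V_χ ⊂ H^{n - s(χ)/m, s(χ)/m}` / Shioda's `V(β) ⊂ H^{|β|-1, n+1-|β|}`) that a non-zero class of
`V(β)`, all `βᵢ ≠ 0`, whose `A`-pull-back is of type `(p, p)` forces `|β| = p + 1`, i.e.
`2 Σ⟨βᵢ⟩ = m (2p + 2)`. Then `α ∈ 𝔅`: `Σ αᵢ = 0` (else `V(α) = 0`), and for every unit `t`,
`π_{tα} c ≠ 0` (the support of a rational class is `(ℤ/m)ˣ`-stable) and
`A^*(π_{tα} c) ∈ H^{p,p}_A` (`π_{tα}` preserves the `(p,p)`-classes of the fixed model `A`), so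
`2 |tα| = 2p + 2`. [cite: Ran1980, §1 Prop. 1.7 (ii)–(iii)]
[cite: Shioda1979PJA, §1 (definition of 𝔅ⁿₘ) and §4] -/
theorem FermatCharacter.isHodge_of_fermatProjector_ne_zero [NeZero m] (hp : 0 < p)
    (hE4 : ∀ (A : HodgeModel (2 * p) (fermatHypersurface (2 * p) m)) (β : Fin (2 * p + 2) → ZMod m),
      (∀ i, β i ≠ 0) →
      (∃ x ∈ fermatEigenspace m β (2 * p), x ≠ 0 ∧ A.pullback (2 * p) x ∈ A.hodgePQ (2 * p) p p) →
        2 * FermatCharacter.normSum β = m * (2 * p + 2))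
    {c : complexBetti (fermatHypersurface (2 * p) m) (2 * p)} (hc : IsRationalClass c)
    {A : HodgeModel (2 * p) (fermatHypersurface (2 * p) m)} (hA : A.pullback (2 * p) c ∈ A.hodgePQ (2 * p) p p)
    {α : Fin (2 * p + 2) → ZMod m} (hα : ∀ i, α i ≠ 0) (hne : fermatProjector m α (2 * p) c ≠ 0) :
    FermatCharacter.IsHodge α := by
  have hX : IsSmoothProjective (2 * p) (fermatHypersurface (2 * p) m) :=
    isSmoothProjective_fermatHypersurface (by omega) (NeZero.one_le)
  refine ⟨⟨hα, ?_⟩, fun t ↦ ?_⟩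
  · -- `Σ αᵢ = 0`, for otherwise `V(α) = 0` and `π_α c ∈ V(α)` would vanish
    by_contra hsum
    exact hne ((Submodule.eq_bot_iff _).mp (fermatEigenspace_eq_bot_of_sum_ne_zero hsum (2 * p)) _
      (fermatProjector_mem α c))
  · -- `π_{tα} c ≠ 0` is of type `(p, p)` in the model `A` and lies in `V(tα)`
    have hne' : fermatProjector m (fun i ↦ (t : ZMod m) * α i) (2 * p) c ≠ 0 :=
      fermatProjector_ne_zero_of_unitMul hc hne t
    have hpq : A.pullback (2 * p) (fermatProjector m (fun i ↦ (t : ZMod m) * α i) (2 * p) c) ∈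
        A.hodgePQ (2 * p) p p :=
      A.pullback_eigenProjector_mem_hodgePQ (fermatPolynomial ℂ (2 * p) m)
        (fermatGroup_le_diagonalStabilizer m) (fermatCharacter m fun i ↦ (t : ZMod m) * α i) hX hA
    have hα' : ∀ i, (t : ZMod m) * α i ≠ 0 := fun i ↦ (Units.mul_right_eq_zero t).not.mpr (hα i)
    exact hE4 A _ hα' ⟨_, fermatProjector_mem _ c, hne', hpq⟩

/-! ### The assembly of the middle degree (Ran Thm. 4.9; Shioda Thm. 1) -/

/-- **The middle-degree case of the Hodge conjecture for `X²ᵖₘ` from the eigenspace structure**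
(standard model, `p > 0`, `m ≥ 1`). Hypotheses, all on the tree's carriers: `hE2` — `V(α) ∩ H²ᵖ = 0`
for `α ≠ 0` with some `αᵢ = 0` (Ran Prop. 1.7 (i): only the characters of `𝔄 ∪ {0}` occur in the
middle degree); `hE0` — the invariant classes `V(0) ∩ H²ᵖ` are restricted from `ℙ²ᵖ⁺¹` (Shioda:
`Hⁿ(Xⁿₘ)^{Gⁿₘ} = Hⁿ(ℙⁿ) = ℂ hᵖ`, the quotient `Xⁿₘ/Gⁿₘ ≅ ℙⁿ`); `hE4` — the Hodge types of the
`V(α)` in the `(p, p)` case (Ran Prop. 1.7 (ii), as in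
`FermatCharacter.isHodge_of_fermatProjector_ne_zero`); `hB` — for
every Hodge character `α ∈ 𝔅²ᵖₘ` the eigenspace `V(α) ∩ H²ᵖ` consists of algebraic classes (Ran
§§2–3 with Cor. 4.7; Shioda: the inductive structure under `(Pⁿₘ)`). Conclusion: every rational
class of type `(p, p)` in `H²ᵖ(X(ℂ); ℂ)` is algebraic. Proof: `c = Σ_α π_α c`; `π_0 c ∈ V(0)` is
restricted from projective space hence algebraic (`range_map_projectiveSpace_le_algebraicClasses`);
a non-zero `π_α c`, `α ≠ 0`, has all `αᵢ ≠ 0` by `hE2`, so `α ∈ 𝔅` by the previous theorem and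
`π_α c ∈ V(α)` is algebraic by `hB`. [cite: Ran1980, Thm. 4.9 and §1 Prop. 1.7]
[cite: Shioda1979PJA, §2 Thm. 1 and §4] [cite: Shioda1979HodgeFermat, §1 Thm. I] -/
theorem mem_algebraicClasses_fermat_middle_of_eigenspaces [NeZero m] (hp : 0 < p)
    (hE2 : ∀ α : Fin (2 * p + 2) → ZMod m, α ≠ 0 → (∃ i, α i = 0) → fermatEigenspace m α (2 * p) = ⊥)
    (hE0 : fermatEigenspace m (0 : Fin (2 * p + 2) → ZMod m) (2 * p) ≤
      LinearMap.range (complexBetti.map (SmoothHypersurface.hypersurfaceι (fermatPolynomial ℂ (2 * p) m)) (2 * p)).hom)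
    (hE4 : ∀ (A : HodgeModel (2 * p) (fermatHypersurface (2 * p) m)) (β : Fin (2 * p + 2) → ZMod m),
      (∀ i, β i ≠ 0) →
      (∃ x ∈ fermatEigenspace m β (2 * p), x ≠ 0 ∧ A.pullback (2 * p) x ∈ A.hodgePQ (2 * p) p p) →
        2 * FermatCharacter.normSum β = m * (2 * p + 2))
    (hB : ∀ α : Fin (2 * p + 2) → ZMod m, FermatCharacter.IsHodge α →
      fermatEigenspace m α (2 * p) ≤ algebraicClasses (fermatHypersurface (2 * p) m) p) :
    ∀ c : complexBetti (fermatHypersurface (2 * p) m) (2 * p), IsRationalClass c →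
      IsOfHodgeType (2 * p) (fermatHypersurface (2 * p) m) (2 * p) p p c →
        c ∈ algebraicClasses (fermatHypersurface (2 * p) m) p := by
  intro c hc hpp
  obtain ⟨A, hA⟩ := hpp
  have hX : IsSmoothProjective (2 * p) (fermatHypersurface (2 * p) m) :=
    isSmoothProjective_fermatHypersurface (by omega) (NeZero.one_le)
  rw [← sum_fermatProjector c]
  refine Submodule.sum_mem _ fun α _ ↦ ?_
  by_cases hα0 : fermatProjector m α (2 * p) c = 0
  · rw [hα0]; exact Submodule.zero_mem _
  have hmem : fermatProjector m α (2 * p) c ∈ fermatEigenspace m α (2 * p) := fermatProjector_mem α c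
  by_cases hzero : α = 0
  · -- the invariant component comes from `ℙ²ᵖ⁺¹`, hence is algebraic
    subst hzero
    exact range_map_projectiveSpace_le_algebraicClasses hX _ p (hE0 hmem)
  by_cases hsome : ∃ i, α i = 0
  · -- `V(α) = 0` in the middle degree: the component vanishes
    exact absurd ((Submodule.eq_bot_iff _).mp (hE2 α hzero hsome) _ hmem) hα0
  push Not at hsome
  -- all `αᵢ ≠ 0`: `α` is a Hodge character and `V(α)` is algebraic
  exact hB α (FermatCharacter.isHodge_of_fermatProjector_ne_zero hp hE4 hc hA hsome hα0) hmem

/-- **Prime degree (Ran Thm. 4.9: "if `m` is prime, the Hodge subspace is generated by the homology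
classes of linear spaces").** For `m = ℓ` prime, in the previous assembly it suffices that `V(α)`
consist of algebraic classes for the PAIRED characters `α` (all `αᵢ ≠ 0`, `α ∘ σ = -α` for a
fixed-point-free involution `σ` — the characters met by the classes of the linear subspaces
`x_i = ε x_{σ i}`, `εᵐ = -1`): every Hodge character is paired for `ℓ` prime
(`FermatCharacter.IsHodge.isPaired`, Ran Prop. 1.8 (i) / Koblitz–Ogus, PROVED in the tree).
[cite: Ran1980, Thm. 4.9 and Prop. 1.8 (i)] [cite: Shioda1979PJA, §2 Thm. 1, list item 1)] -/
theorem mem_algebraicClasses_fermat_middle_prime_of_eigenspaces {ℓ : ℕ} [Fact ℓ.Prime] (hp : 0 < p)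
    (hE2 : ∀ α : Fin (2 * p + 2) → ZMod ℓ, α ≠ 0 → (∃ i, α i = 0) → fermatEigenspace ℓ α (2 * p) = ⊥)
    (hE0 : fermatEigenspace ℓ (0 : Fin (2 * p + 2) → ZMod ℓ) (2 * p) ≤
      LinearMap.range (complexBetti.map (SmoothHypersurface.hypersurfaceι (fermatPolynomial ℂ (2 * p) ℓ)) (2 * p)).hom)
    (hE4 : ∀ (A : HodgeModel (2 * p) (fermatHypersurface (2 * p) ℓ)) (β : Fin (2 * p + 2) → ZMod ℓ),
      (∀ i, β i ≠ 0) →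
      (∃ x ∈ fermatEigenspace ℓ β (2 * p), x ≠ 0 ∧ A.pullback (2 * p) x ∈ A.hodgePQ (2 * p) p p) →
        2 * FermatCharacter.normSum β = ℓ * (2 * p + 2))
    (hL : ∀ α : Fin (2 * p + 2) → ZMod ℓ, (∀ i, α i ≠ 0) → FermatCharacter.IsPaired α →
      fermatEigenspace ℓ α (2 * p) ≤ algebraicClasses (fermatHypersurface (2 * p) ℓ) p) :
    ∀ c : complexBetti (fermatHypersurface (2 * p) ℓ) (2 * p), IsRationalClass c →
      IsOfHodgeType (2 * p) (fermatHypersurface (2 * p) ℓ) (2 * p) p p c →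
        c ∈ algebraicClasses (fermatHypersurface (2 * p) ℓ) p :=
  haveI : NeZero ℓ := ⟨(Fact.out : ℓ.Prime).ne_zero⟩
  mem_algebraicClasses_fermat_middle_of_eigenspaces hp hE2 hE0 hE4 fun α hα ↦ hL α hα.1.1 hα.isPaired

/-! ### The named fact from Lefschetz and the eigenspace structure -/

/-- **`hodgeClasses_algebraic_fermat` from Lefschetz and the middle-degree inputs.** Granted the
Lefschetz fact `Voisin2003_smoothHypersurface_algebraicClasses_eq_top` (off the middle degree) and,
for every `p > 0` and every `m` prime or `1 < m ≤ 20`, the four inputs `hE2`, `hE0`, `hE4`, `hB` of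
`mem_algebraicClasses_fermat_middle_of_eigenspaces` on the standard model `V₊(Σᵢ₌₀^{2p+1} xᵢᵐ)`, the
named fact holds (reduction to the standard model: `hodgeClasses_algebraic_fermat_of_fermatHypersurface`).
[cite: Shioda1979PJA, §2 Thm. 1 and the list after it (p. 112)] [cite: Ran1980, Thm. 4.9] -/
theorem hodgeClasses_algebraic_fermat_of_eigenspaces
    (hLef : Voisin2003_smoothHypersurface_algebraicClasses_eq_top)
    (h : ∀ ⦃p m : ℕ⦄, m.Prime ∨ (1 < m ∧ m ≤ 20) → 0 < p →
      (∀ α : Fin (2 * p + 2) → ZMod m, α ≠ 0 → (∃ i, α i = 0) → fermatEigenspace m α (2 * p) = ⊥) ∧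
      (fermatEigenspace m (0 : Fin (2 * p + 2) → ZMod m) (2 * p) ≤
        LinearMap.range (complexBetti.map (SmoothHypersurface.hypersurfaceι (fermatPolynomial ℂ (2 * p) m)) (2 * p)).hom) ∧
      (∀ (A : HodgeModel (2 * p) (fermatHypersurface (2 * p) m)) (β : Fin (2 * p + 2) → ZMod m),
        (∀ i, β i ≠ 0) →
        (∃ x ∈ fermatEigenspace m β (2 * p), x ≠ 0 ∧ A.pullback (2 * p) x ∈ A.hodgePQ (2 * p) p p) →
          2 * FermatCharacter.normSum β = m * (2 * p + 2)) ∧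
      (∀ α : Fin (2 * p + 2) → ZMod m, FermatCharacter.IsHodge α →
        fermatEigenspace m α (2 * p) ≤ algebraicClasses (fermatHypersurface (2 * p) m) p)) :
    hodgeClasses_algebraic_fermat := by
  refine hodgeClasses_algebraic_fermat_of_fermatHypersurface hLef fun p m hm hp c hc hpp ↦ ?_
  haveI : NeZero m := ⟨by have := one_le_of_prime_or hm; omega⟩
  obtain ⟨hE2, hE0, hE4, hB⟩ := h hm hp
  exact mem_algebraicClasses_fermat_middle_of_eigenspaces hp hE2 hE0 hE4 hB c hc hpp

end Literature.AlgebraicGeometry.HodgeTheory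

end
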